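import Summits.Ventures.HodgeRepro2.T5SplitPlaceLocalDegree
import Summits.Ventures.HodgeRepro2.T5InertPrimeToy
import Summits.Ventures.HodgeRepro2.T5RamifiedPrimeToy

/-!
# T5SplitPrimeToy — the prime `5` of `ℚ` SPLITS in `ℚ(ζ₄) = ℚ(i)`: `(5) = (2 − i)(2 + i)`, two
distinct places of local degree `1`

Tier-5 kernel support (N3) — p8, gen 15.  §8(d): uses an L-value-free non-vanishing device: NO.

The split companion of `T5InertPrimeToy` / `T5RamifiedPrimeToy` (non-vacuity of the SPLIT branch of
`T5QuadraticPlaceTrichotomy` and of the hypotheses of `T5SplitPlaceLocalDegree`):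
* `norm_algebraMap_sub_eq_eval_cyclotomic` — `N_{L/K}(a − ζ) = Φ_n(a)` for a primitive `n`-th root
  of unity `ζ` generating `L / K` (Mathlib's `sub_one_norm_eq_eval_cyclotomic` with `1` replaced
  by `a`; the proof is Mathlib's);
* `prime_two_sub_zeta` / `prime_two_add_zeta` — `2 − ζ₄` and `2 + ζ₄` are prime in `𝓞 L`
  (`Ideal.prime_of_irreducible_absNorm_span`: both have norm `Φ₄(±2) = 5`);
* `wFiveA` / `wFiveB` — the places `(2 − ζ₄)`, `(2 + ζ₄)` of `L`, distinct, both over `vFive = (5)`;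
* hence (`T5SplitPlaceLocalDegree`) `e = f = 1` at both and `[L_{(2 ∓ i)} : ℚ_5] = 1`:
  `finrank_adicCompletion_eq_one_A` / `_B`, `bijective_algebraMap_A` / `_B`.

Nothing here identifies which places of the datum split.
-/

namespace Summit.Ventures.HodgeRepro2.T5SplitPrimeToy

open Polynomial Algebra Finset NumberField IsDedekindDomain HeightOneSpectrum

section NormLemma

variable {n : ℕ} [NeZero n] {K L : Type*} [Field K] [Field L] [Algebra K L] {ζ : L}

/-- `N_{L/K}(a − ζ) = Φ_n(a)` for a primitive `n`-th root of unity `ζ` generating `L / K` with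
`Φ_n` irreducible over `K` — Mathlib's `IsPrimitiveRoot.sub_one_norm_eq_eval_cyclotomic` with `1`
replaced by an arbitrary `a ∈ K` (same proof: the norm is the product over the embeddings, which
are in bijection with the primitive roots, and `Φ_n = ∏ (X − η)`). -/
theorem norm_algebraMap_sub_eq_eval_cyclotomic (hζ : IsPrimitiveRoot ζ n)
    [IsCyclotomicExtension {n} K L] (hirr : Irreducible (cyclotomic n K)) (a : K) :
    Algebra.norm K (algebraMap K L a - ζ) = eval a (cyclotomic n K) := by
  haveI := IsCyclotomicExtension.neZero' n K L
  let E := AlgebraicClosure L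
  obtain ⟨z, hz⟩ := IsAlgClosed.exists_root _ (degree_cyclotomic_pos n E (NeZero.pos _)).ne.symm
  apply (algebraMap K E).injective
  letI := IsCyclotomicExtension.finiteDimensional {n} K L
  letI := IsCyclotomicExtension.isGalois {n} K L
  rw [norm_eq_prod_embeddings]
  have Hprod : (Finset.univ.prod fun σ : L →ₐ[K] E => σ (algebraMap K L a - ζ)) =
      eval (algebraMap K E a) (cyclotomic' n E) := by
    rw [cyclotomic', eval_prod, ← @Finset.prod_attach E E, ← univ_eq_attach]
    refine Fintype.prod_equiv (hζ.embeddingsEquivPrimitiveRoots E hirr) _ _ fun σ => ?_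
    simp [hζ.embeddingsEquivPrimitiveRoots_apply_coe]
  have : NeZero (n : E) := NeZero.of_faithfulSMul K _ n
  rw [Hprod, cyclotomic', ← cyclotomic_eq_prod_X_sub_primitiveRoots (isRoot_cyclotomic_iff.1 hz),
    ← map_cyclotomic n (algebraMap K E), eval_map, eval₂_hom]

end NormLemma

section Five

variable (L : Type*) [Field L] [CharZero L] [IsCyclotomicExtension {2 ^ 2} ℚ L]

/-- `N_{L/ℚ}(a − ζ₄) = a² + 1`. -/
theorem norm_sub_zeta (a : ℚ) :
    Algebra.norm ℚ (algebraMap ℚ L a - IsCyclotomicExtension.zeta (2 ^ 2) ℚ L) = a ^ 2 + 1 := by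
  rw [norm_algebraMap_sub_eq_eval_cyclotomic (IsCyclotomicExtension.zeta_spec (2 ^ 2) ℚ L)
    (cyclotomic.irreducible_rat (by norm_num)), show (2 : ℕ) ^ 2 = 4 from rfl,
    T5InertPrimeToy.cyclotomic_four_eq]
  simp

/-- The norm `𝓞 L → ℤ` of `a − ζ₄`, `a ∈ ℤ`, is `a² + 1` (through `Algebra.norm_localization`). -/
theorem norm_int_sub_toInteger (a : ℤ) :
    haveI : NumberField L := IsCyclotomicExtension.numberField {2 ^ 2} ℚ L
    Algebra.norm ℤ ((a : 𝓞 L) - (IsCyclotomicExtension.zeta_spec (2 ^ 2) ℚ L).toInteger) =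
      a ^ 2 + 1 := by
  haveI : NumberField L := IsCyclotomicExtension.numberField {2 ^ 2} ℚ L
  apply RingHom.injective_int (algebraMap ℤ ℚ)
  rw [← Algebra.norm_localization (Sₘ := L) ℤ (nonZeroDivisors ℤ)]
  have h := norm_sub_zeta L (a : ℚ)
  rw [map_intCast] at h
  rw [map_sub (algebraMap (𝓞 L) L), map_intCast,
    show (algebraMap (𝓞 L) L) (IsCyclotomicExtension.zeta_spec (2 ^ 2) ℚ L).toInteger =
      IsCyclotomicExtension.zeta (2 ^ 2) ℚ L from rfl, h, algebraMap_int_eq, eq_intCast]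
  push_cast
  ring

/-- `2 − ζ₄` is prime in `𝓞 L` (its norm is `5`). -/
theorem prime_two_sub_toInteger :
    haveI : NumberField L := IsCyclotomicExtension.numberField {2 ^ 2} ℚ L
    Prime ((2 : 𝓞 L) - (IsCyclotomicExtension.zeta_spec (2 ^ 2) ℚ L).toInteger) := by
  haveI : NumberField L := IsCyclotomicExtension.numberField {2 ^ 2} ℚ L
  have hn : Algebra.norm ℤ ((2 : 𝓞 L) - (IsCyclotomicExtension.zeta_spec (2 ^ 2) ℚ L).toInteger) =
      5 := by simpa using norm_int_sub_toInteger L 2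
  refine Ideal.prime_of_irreducible_absNorm_span (fun h => ?_) ?_
  · rw [h, Algebra.norm_zero] at hn
    norm_num at hn
  · rw [Ideal.absNorm_span_singleton, hn, Nat.irreducible_iff_prime]
    exact Nat.prime_iff.1 (by norm_num)

/-- `−2 − ζ₄` is prime in `𝓞 L` (its norm is `5`). -/
theorem prime_neg_two_sub_toInteger :
    haveI : NumberField L := IsCyclotomicExtension.numberField {2 ^ 2} ℚ L
    Prime ((-2 : 𝓞 L) - (IsCyclotomicExtension.zeta_spec (2 ^ 2) ℚ L).toInteger) := by
  haveI : NumberField L := IsCyclotomicExtension.numberField {2 ^ 2} ℚ L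
  have hn : Algebra.norm ℤ ((-2 : 𝓞 L) - (IsCyclotomicExtension.zeta_spec (2 ^ 2) ℚ L).toInteger) =
      5 := by simpa using norm_int_sub_toInteger L (-2)
  refine Ideal.prime_of_irreducible_absNorm_span (fun h => ?_) ?_
  · rw [h, Algebra.norm_zero] at hn
    norm_num at hn
  · rw [Ideal.absNorm_span_singleton, hn, Nat.irreducible_iff_prime]
    exact Nat.prime_iff.1 (by norm_num)

/-- `2 + ζ₄` is prime in `𝓞 L`. -/
theorem prime_two_add_toInteger :
    haveI : NumberField L := IsCyclotomicExtension.numberField {2 ^ 2} ℚ L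
    Prime ((2 : 𝓞 L) + (IsCyclotomicExtension.zeta_spec (2 ^ 2) ℚ L).toInteger) := by
  haveI : NumberField L := IsCyclotomicExtension.numberField {2 ^ 2} ℚ L
  have h := (prime_neg_two_sub_toInteger L).neg
  rwa [neg_sub, sub_neg_eq_add, add_comm] at h

/-- `(2 − ζ₄)(2 + ζ₄) = 5`. -/
theorem mul_eq_five :
    haveI : NumberField L := IsCyclotomicExtension.numberField {2 ^ 2} ℚ L
    ((2 : 𝓞 L) - (IsCyclotomicExtension.zeta_spec (2 ^ 2) ℚ L).toInteger) *
      ((2 : 𝓞 L) + (IsCyclotomicExtension.zeta_spec (2 ^ 2) ℚ L).toInteger) = 5 := by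
  haveI : NumberField L := IsCyclotomicExtension.numberField {2 ^ 2} ℚ L
  have h := T5RamifiedPrimeToy.toInteger_sq L
  linear_combination -h

/-- `5` is prime in `𝓞 ℚ`. -/
theorem prime_five_ringOfIntegers_rat : Prime (5 : 𝓞 ℚ) :=
  (MulEquiv.prime_iff Rat.ringOfIntegersEquiv).1
    (by rw [map_ofNat]; exact Nat.prime_iff_prime_int.1 (by norm_num))

/-- The place `(5)` of `ℚ`. -/
noncomputable def vFive : HeightOneSpectrum (𝓞 ℚ) where
  asIdeal := Ideal.span {(5 : 𝓞 ℚ)}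
  isPrime := (Ideal.span_singleton_prime prime_five_ringOfIntegers_rat.ne_zero).2
    prime_five_ringOfIntegers_rat
  ne_bot := by simp [prime_five_ringOfIntegers_rat.ne_zero]

/-- The place `(2 − ζ₄)` of `L`. -/
noncomputable def wFiveA :
    haveI : NumberField L := IsCyclotomicExtension.numberField {2 ^ 2} ℚ L
    HeightOneSpectrum (𝓞 L) :=
  haveI : NumberField L := IsCyclotomicExtension.numberField {2 ^ 2} ℚ L
  { asIdeal := Ideal.span {(2 : 𝓞 L) - (IsCyclotomicExtension.zeta_spec (2 ^ 2) ℚ L).toInteger}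
    isPrime := (Ideal.span_singleton_prime (prime_two_sub_toInteger L).ne_zero).2
      (prime_two_sub_toInteger L)
    ne_bot := by
      rw [Ne, Ideal.span_singleton_eq_bot]
      exact (prime_two_sub_toInteger L).ne_zero }

/-- The place `(2 + ζ₄)` of `L`. -/
noncomputable def wFiveB :
    haveI : NumberField L := IsCyclotomicExtension.numberField {2 ^ 2} ℚ L
    HeightOneSpectrum (𝓞 L) :=
  haveI : NumberField L := IsCyclotomicExtension.numberField {2 ^ 2} ℚ L
  { asIdeal := Ideal.span {(2 : 𝓞 L) + (IsCyclotomicExtension.zeta_spec (2 ^ 2) ℚ L).toInteger}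
    isPrime := (Ideal.span_singleton_prime (prime_two_add_toInteger L).ne_zero).2
      (prime_two_add_toInteger L)
    ne_bot := by
      rw [Ne, Ideal.span_singleton_eq_bot]
      exact (prime_two_add_toInteger L).ne_zero }

/-- `5 ∈ (2 − ζ₄)` and `5 ∈ (2 + ζ₄)`. -/
theorem five_mem_A :
    haveI : NumberField L := IsCyclotomicExtension.numberField {2 ^ 2} ℚ L
    (5 : 𝓞 L) ∈ (wFiveA L).asIdeal := by
  haveI : NumberField L := IsCyclotomicExtension.numberField {2 ^ 2} ℚ L
  rw [← mul_eq_five L]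
  exact Ideal.mul_mem_right _ _ (Ideal.mem_span_singleton_self _)

/-- `5 ∈ (2 + ζ₄)`. -/
theorem five_mem_B :
    haveI : NumberField L := IsCyclotomicExtension.numberField {2 ^ 2} ℚ L
    (5 : 𝓞 L) ∈ (wFiveB L).asIdeal := by
  haveI : NumberField L := IsCyclotomicExtension.numberField {2 ^ 2} ℚ L
  rw [← mul_eq_five L]
  exact Ideal.mul_mem_left _ _ (Ideal.mem_span_singleton_self _)

/-- The two places are distinct: otherwise `4 = (2 − ζ₄) + (2 + ζ₄)` and `5` lie in one prime,
so `1 = 5 − 4` does. -/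
theorem wFiveA_ne_wFiveB :
    haveI : NumberField L := IsCyclotomicExtension.numberField {2 ^ 2} ℚ L
    wFiveA L ≠ wFiveB L := by
  haveI : NumberField L := IsCyclotomicExtension.numberField {2 ^ 2} ℚ L
  intro h
  have hA : (2 : 𝓞 L) - (IsCyclotomicExtension.zeta_spec (2 ^ 2) ℚ L).toInteger ∈ (wFiveB L).asIdeal := by
    rw [← h]
    exact Ideal.mem_span_singleton_self _
  have hB : (2 : 𝓞 L) + (IsCyclotomicExtension.zeta_spec (2 ^ 2) ℚ L).toInteger ∈ (wFiveB L).asIdeal :=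
    Ideal.mem_span_singleton_self _
  have h4 : (4 : 𝓞 L) ∈ (wFiveB L).asIdeal := by
    have := Ideal.add_mem _ hA hB
    convert this using 1
    ring
  have h1 : (1 : 𝓞 L) ∈ (wFiveB L).asIdeal := by
    have := Ideal.sub_mem _ (five_mem_B L) h4
    convert this using 1
    norm_num
  exact (wFiveB L).isPrime.ne_top ((Ideal.eq_top_iff_one _).2 h1)

/-- `(2 − ζ₄)` lies over `(5)`. -/
theorem liesOverA :
    haveI : NumberField L := IsCyclotomicExtension.numberField {2 ^ 2} ℚ L
    (wFiveA L).asIdeal.LiesOver vFive.asIdeal := by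
  haveI : NumberField L := IsCyclotomicExtension.numberField {2 ^ 2} ℚ L
  refine ⟨vFive.isMaximal.eq_of_le (Ideal.comap_ne_top _ (wFiveA L).isPrime.ne_top) ?_⟩
  refine Ideal.le_comap_of_map_le ?_
  rw [show vFive.asIdeal = Ideal.span {(5 : 𝓞 ℚ)} from rfl, Ideal.map_span, Set.image_singleton,
    map_ofNat, Ideal.span_singleton_le_iff_mem]
  exact five_mem_A L

/-- `(2 + ζ₄)` lies over `(5)`. -/
theorem liesOverB :
    haveI : NumberField L := IsCyclotomicExtension.numberField {2 ^ 2} ℚ L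
    (wFiveB L).asIdeal.LiesOver vFive.asIdeal := by
  haveI : NumberField L := IsCyclotomicExtension.numberField {2 ^ 2} ℚ L
  refine ⟨vFive.isMaximal.eq_of_le (Ideal.comap_ne_top _ (wFiveB L).isPrime.ne_top) ?_⟩
  refine Ideal.le_comap_of_map_le ?_
  rw [show vFive.asIdeal = Ideal.span {(5 : 𝓞 ℚ)} from rfl, Ideal.map_span, Set.image_singleton,
    map_ofNat, Ideal.span_singleton_le_iff_mem]
  exact five_mem_B L

/-- NON-VACUITY of the split branch: two distinct places of `L` over the place `5` of `ℚ`. -/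
theorem split_branch_satisfiable :
    haveI : NumberField L := IsCyclotomicExtension.numberField {2 ^ 2} ℚ L
    ∃ (v : HeightOneSpectrum (𝓞 ℚ)) (w w' : HeightOneSpectrum (𝓞 L)),
      w ≠ w' ∧ w.asIdeal.LiesOver v.asIdeal ∧ w'.asIdeal.LiesOver v.asIdeal :=
  ⟨vFive, wFiveA L, wFiveB L, wFiveA_ne_wFiveB L, liesOverA L, liesOverB L⟩

/-- **`[L_{(2 − i)} : ℚ_5] = 1`**. -/
theorem finrank_adicCompletion_eq_one_A :
    haveI : NumberField L := IsCyclotomicExtension.numberField {2 ^ 2} ℚ L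
    haveI := liesOverA L
    Module.finrank (vFive.adicCompletion ℚ) ((wFiveA L).adicCompletion L) = 1 := by
  haveI : NumberField L := IsCyclotomicExtension.numberField {2 ^ 2} ℚ L
  haveI := liesOverA L
  haveI := liesOverB L
  exact T5SplitPlaceLocalDegree.finrank_adicCompletion_eq_one_of_ne vFive (wFiveA L) (wFiveB L)
    (T5InertPrimeToy.finrank_eq_two L) (wFiveA_ne_wFiveB L)

/-- **`[L_{(2 + i)} : ℚ_5] = 1`**. -/
theorem finrank_adicCompletion_eq_one_B :
    haveI : NumberField L := IsCyclotomicExtension.numberField {2 ^ 2} ℚ L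
    haveI := liesOverB L
    Module.finrank (vFive.adicCompletion ℚ) ((wFiveB L).adicCompletion L) = 1 := by
  haveI : NumberField L := IsCyclotomicExtension.numberField {2 ^ 2} ℚ L
  haveI := liesOverA L
  haveI := liesOverB L
  exact T5SplitPlaceLocalDegree.finrank_adicCompletion_eq_one_of_ne vFive (wFiveB L) (wFiveA L)
    (T5InertPrimeToy.finrank_eq_two L) (wFiveA_ne_wFiveB L).symm

/-- `ℚ_5 → L_{(2 − i)}` is bijective: the first factor of `ℚ(i) ⊗ ℚ_5 = ℚ_5 × ℚ_5`. -/
theorem bijective_algebraMap_A :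
    haveI : NumberField L := IsCyclotomicExtension.numberField {2 ^ 2} ℚ L
    haveI := liesOverA L
    Function.Bijective (algebraMap (vFive.adicCompletion ℚ) ((wFiveA L).adicCompletion L)) := by
  haveI : NumberField L := IsCyclotomicExtension.numberField {2 ^ 2} ℚ L
  haveI := liesOverA L
  exact Algebra.finrank_eq_one_iff_bijective_algebraMap.1 (finrank_adicCompletion_eq_one_A L)

/-- `ℚ_5 → L_{(2 + i)}` is bijective: the second factor. -/
theorem bijective_algebraMap_B :
    haveI : NumberField L := IsCyclotomicExtension.numberField {2 ^ 2} ℚ L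
    haveI := liesOverB L
    Function.Bijective (algebraMap (vFive.adicCompletion ℚ) ((wFiveB L).adicCompletion L)) := by
  haveI : NumberField L := IsCyclotomicExtension.numberField {2 ^ 2} ℚ L
  haveI := liesOverB L
  exact Algebra.finrank_eq_one_iff_bijective_algebraMap.1 (finrank_adicCompletion_eq_one_B L)

end Five

end Summit.Ventures.HodgeRepro2.T5SplitPrimeToy
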